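import Summits.KontsevichZagierPeriods.KontsevichZagierPeriods.Theorems.BetaCancellation.Negative.PiLinkMoves

/-!
# `BetaCancellation` (stmt-KontsevichZagierPeriods-13633) — `BetaCancellation → KZ.PiCancellation`

Second half of the `π`-link (first half: `Negative/PiLinkMoves.lean` — `betaHalfRep`,
`invSqrtRep`, `twoSqrtRep` and moves 1–3). Here: move 4 (`∫_{-1}^{1} 2√(1−x²) dx = ∬_{disc} 1`,
one Newton–Leibniz move along `y` onto `KZ.piRep`), the assembly
`equivalent_betaHalfRep_piRep : [β(1/2,1/2)] ∼ [π]`, `betaHalfRep_value : B(1/2,1/2) = π` (by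
soundness), and the reduction `piCancellation_of_betaCancellation : BetaCancellation →
KZ.PiCancellation`: the crux is at least as strong as the OPEN `π`-cancellation crux of route
AyoubSpecialisation (stmt-KontsevichZagierPeriods-0540). With `betaCancellation_of_summit`
(`Negative/KernelForm.lean`): `KZ.PiCancellation ≤ BetaCancellation ≤ KZKernelConjecture`.
cdisprove (refuter) file; sorry-free, axioms ⊆ {propext, Classical.choice, Quot.sound}.
[Kontsevich–Zagier 2001, §1.1 eq. (1)]
-/

noncomputable section

set_option linter.dupNamespace false

namespace Summit.KontsevichZagierPeriods.KontsevichZagierPeriods.BetaCancellationNegative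

open MeasureTheory Set
open Literature.NumberTheory.Transcendental
open Literature.NumberTheory.Transcendental.KZ
open Literature.ModelTheory.ExponentialFields (IsSemialgebraic isSemialgebraic_univ)
open MvPolynomial (aeval X C)
open Summit.KontsevichZagierPeriods.KontsevichZagierPeriods.Theses.TerasomaMultiplication
  (BetaCancellation)
open Literature.NumberTheory.Transcendental.KZreg (unitIoo isSemialgebraic_unitIoo volume_unitIoo)

/-! ## `BetaCancellation → KZ.PiCancellation`: move 4 and the reduction -/

/-! ### §5 Move 4 (rule 3): `∫_{-1}^{1} 2√(1−x²) dx = ∬_{x²+y²≤1} 1` -/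

/-- The band `{(x,y) | x ∈ (-1,1), −√(1−x²) ≤ y ≤ √(1−x²)}` = the closed disc minus `(±1, 0)`,
in the Newton–Leibniz format. [folklore] -/
def discBand : Set (Fin 2 → ℝ) :=
  {z | (Fin.init z : Fin 1 → ℝ) ∈ symIoo ∧ -√(1 - (Fin.init z : Fin 1 → ℝ) 0 ^ 2) ≤ z (Fin.last 1) ∧
    z (Fin.last 1) ≤ √(1 - (Fin.init z : Fin 1 → ℝ) 0 ^ 2)}

/-- The band is the disc cut by the open strip `−1 < x < 1`. [folklore] -/
theorem discBand_eq : discBand = piDisc ∩ {z | -1 < z 0 ∧ z 0 < 1} := by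
  ext z
  have e0 : (Fin.init z : Fin 1 → ℝ) 0 = z 0 := rfl
  have e1 : z (Fin.last 1) = z 1 := rfl
  simp only [discBand, mem_setOf_eq, mem_symIoo, mem_Ioo, e0, e1, mem_inter_iff, mem_piDisc]
  constructor
  · rintro ⟨⟨h1, h2⟩, h3, h4⟩
    have hu : 0 ≤ 1 - z 0 ^ 2 := by nlinarith
    have hab : |z 1| ≤ √(1 - z 0 ^ 2) := abs_le.mpr ⟨h3, h4⟩
    have h5 := pow_le_pow_left₀ (abs_nonneg (z 1)) hab 2
    rw [sq_abs, Real.sq_sqrt hu] at h5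
    exact ⟨by linarith, h1, h2⟩
  · rintro ⟨h, h1, h2⟩
    have hab : |z 1| ≤ √(1 - z 0 ^ 2) := Real.abs_le_sqrt (by nlinarith)
    exact ⟨⟨h1, h2⟩, (abs_le.mp hab).1, (abs_le.mp hab).2⟩

/-- The band is `ℚ`-semialgebraic. [folklore] -/
theorem isSemialgebraic_discBand : IsSemialgebraic ℚ discBand := by
  have h1 := Literature.ModelTheory.ExponentialFields.isSemialgebraic_setOf_eval_lt (k := ℚ) (R := ℝ)
    (-1 : MvPolynomial (Fin 2) ℚ) (X 0)
  have h2 := Literature.ModelTheory.ExponentialFields.isSemialgebraic_setOf_eval_lt (k := ℚ) (R := ℝ)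
    (X 0 : MvPolynomial (Fin 2) ℚ) 1
  have h := isSemialgebraic_piDisc.inter (h1.inter h2)
  simp only [map_neg, map_one, MvPolynomial.aeval_X] at h
  rw [discBand_eq]
  convert h using 1
  ext z
  simp

/-- The band lies in the disc. [folklore] -/
theorem discBand_subset_piDisc : discBand ⊆ piDisc := by
  rw [discBand_eq]
  exact inter_subset_left

/-- The disc minus the band is null (it lies on the lines `x = ±1`). [folklore] -/
theorem volume_piDisc_diff_discBand : volume (piDisc \ discBand) = 0 := by
  refine measure_mono_null (fun z hz => ?_)
    (measure_union_null (volume_setOf_apply_eq_zero (0 : Fin 2) (-1))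
      (volume_setOf_apply_eq_zero (0 : Fin 2) 1))
  rw [discBand_eq] at hz
  simp only [mem_sdiff, mem_inter_iff, mem_piDisc, mem_setOf_eq, not_and, not_lt] at hz
  obtain ⟨hd, hno⟩ := hz
  have hsq : z 0 ^ 2 ≤ 1 := by nlinarith [sq_nonneg (z 1)]
  have hz0 : -1 ≤ z 0 ∧ z 0 ≤ 1 := abs_le.mp (abs_le_one_iff_mul_self_le_one.mpr (by nlinarith))
  simp only [mem_union, mem_setOf_eq]
  rcases hz0.1.lt_or_eq with h | h
  · exact Or.inr (le_antisymm hz0.2 (hno hd h))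
  · exact Or.inl h.symm

/-- **Move 4 (rule 3)**: `[disc band, 1] − [(-1,1), 2√(1−x²)]` is ONE Newton–Leibniz move along
`y` with primitive `F(x,y) = y`. [cite: KontsevichZagier2001, §1.1 eq. (1)] -/
theorem piRep_restrict_sub_twoSqrtRep_mem :
    of (piRep.restrict discBand isSemialgebraic_discBand discBand_subset_piDisc) - of twoSqrtRep ∈
      newtonLeibnizRel := by
  have hb : IsSemialgebraicFunOn ℚ symIoo (fun x : Fin 1 → ℝ => √(1 - x 0 ^ 2)) :=
    (IsSemialgebraicFunOn.sqrt_holds (isSemialgebraicFunOn_aeval isSemialgebraic_symIoo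
      (1 - X 0 ^ 2))).congr fun x _ => by simp
  refine ⟨1, _, twoSqrtRep, fun x => -√(1 - x 0 ^ 2), fun x => √(1 - x 0 ^ 2), fun z => z (Fin.last 1),
    ?_, ?_, hb, fun x _ => ?_, rfl, ?_, ?_, ?_, rfl⟩
  · exact (isSemialgebraicFunOn_aeval isSemialgebraic_discBand (X (Fin.last 1))).congr fun z _ => by
      simp
  · exact hb.neg.congr fun x _ => by simp
  · exact neg_le_self (Real.sqrt_nonneg _)
  · intro x _
    simp only [Fin.snoc_last]
    exact continuousOn_id
  · intro x _ t _
    simp only [Fin.snoc_last, IntegralRep.integrand_restrict, piRep_integrand]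
    exact hasDerivAt_id' t
  · intro x _
    simp only [Fin.snoc_last, twoSqrtRep_integrand]
    ring

/-- **`[(-1,1), 2√(1−x²)] ∼ [π]`** (move 4 plus the null boundary `x = ±1`).
[cite: KontsevichZagier2001, §1.1 eq. (1)] -/
theorem equivalent_twoSqrtRep_piRep : Equivalent twoSqrtRep piRep := by
  have h1 : Equivalent (piRep.restrict discBand isSemialgebraic_discBand discBand_subset_piDisc)
      twoSqrtRep :=
    newtonLeibnizRel_subset_relations piRep_restrict_sub_twoSqrtRep_mem
  have h2 : Equivalent piRep (piRep.restrict discBand isSemialgebraic_discBand discBand_subset_piDisc) :=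
    piRep.of_sub_of_restrict_mem_relations isSemialgebraic_discBand discBand_subset_piDisc
      volume_piDisc_diff_discBand
  exact (h2.trans h1).symm

/-- **`[β(1/2,1/2)] ∼ [π]` inside the calculus** (four moves: affine substitution, KZ's
`1/√(1−x²) ↔ 2√(1−x²)` step, and the disc as the region under `±√(1−x²)`). The value identity is
`B(1/2,1/2) = Γ(1/2)² = π`. [cite: KontsevichZagier2001, §1.1] -/
theorem equivalent_betaHalfRep_piRep : Equivalent betaHalfRep piRep := by
  have h1 : Equivalent invSqrtRep betaHalfRep :=
    changeOfVariablesRel_subset_relations invSqrtRep_sub_betaHalfRep_mem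
  exact (h1.symm.trans equivalent_invSqrtRep_twoSqrtRep).trans equivalent_twoSqrtRep_piRep

/-- Sanity check by soundness: `B(1/2,1/2) = π`, read off the move chain. [folklore] -/
theorem betaHalfRep_value : betaHalfRep.value = Real.pi := by
  rw [Equivalent.value_eq_holds equivalent_betaHalfRep_piRep, piRep_value]

/-! ### §6 The reduction -/

/-- **Cancellation by `β(1/2,1/2)` implies `π`-cancellation**: if the instance `a = b = 1/2` of the
crux holds then `[π]` is a non-zero-divisor on `FormalRep ⧸ relations` (`KZ.PiCancellation`, the
open crux 0540 of route AyoubSpecialisation). Proof: `c ≡ [r] − [r']` (`exists_integralRep_sub`),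
`[π]·c ∈ relations ⇒ [π]×r ∼ [π]×r' ⇒ β×r ∼ β×r'` (`[β] ∼ [π]`, two-sided ideal) `⇒ r ∼ r'`.
[folklore] -/
theorem piCancellation_of_kernelCancellation_half
    (h : KernelCancellation (betaKernel (1/2) (1/2))) : KZ.PiCancellation := by
  intro c hc
  obtain ⟨n, m, r, r', hrel⟩ := exists_integralRep_sub_holds c
  have h1 : of piRep * (of r - of r') ∈ relations := by
    have h' : of piRep * (c - (of r - of r')) ∈ relations := mul_mem_relations_left_holds _ _ hrel
    have := relations.sub_mem hc h'
    rwa [← mul_sub, sub_sub_cancel] at this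
  rw [mul_sub, of_mul_of, of_mul_of] at h1
  have h2 : Equivalent (betaHalfRep.prod r) (betaHalfRep.prod r') :=
    ((Equivalent.prod equivalent_betaHalfRep_piRep (Equivalent.refl r)).trans h1).trans
      (Equivalent.prod equivalent_betaHalfRep_piRep (Equivalent.refl r')).symm
  have h3 : Equivalent r r' :=
    h r r' _ _ (isPinned_prod betaHalfRep rfl (fun x _ => rfl) r)
      (isPinned_prod betaHalfRep rfl (fun x _ => rfl) r') h2
  have := relations.add_mem hrel h3
  simpa using this

/-- **`BetaCancellation → KZ.PiCancellation`.** The crux is at least as strong as the open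
`π`-cancellation crux of route AyoubSpecialisation (stmt-KontsevichZagierPeriods-0540); together
with §3: `KZ.PiCancellation ≤ BetaCancellation ≤ KZKernelConjecture = summit`. [folklore] -/
theorem piCancellation_of_betaCancellation (h : BetaCancellation) : KZ.PiCancellation :=
  piCancellation_of_kernelCancellation_half
    (betaCancellation_iff.1 h (1/2) (1/2) (by norm_num) (by norm_num))

end Summit.KontsevichZagierPeriods.KontsevichZagierPeriods.BetaCancellationNegative
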